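import Literature.Probability.RandomPlanarGeometry.HexSAWVirginizationCut
import HarnessLib

/-!
# Virginization (II): the chordal reduction

Continuation of `HexSAWVirginizationCut.lean`. `sum_vertexTraversals_le_chordal`: for a discrete
hexagonal domain `Ω_δ` and two endpoints FAR from a lattice disc `B(z₀, N)` whose open part lies in
the vertex set, a bound `≤ C · (mass of all arcs)` for the `x`-mass of the self-avoiding arcs between
any two DOORS of the `N`-circle whose polyline has `k₀` separate traversals of `D(z₀; n, N/2)`
implies the bound `≤ C · (total mass)` for the `x^{#vertices}`-mass of the SAWs whose vertex
sequence has `2(k₀+1)` weak vertex traversals of `D(z₀; r, R)`: cut each SAW at its first and last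
vertex in the closed `N`-disc (two-sided domain Markov property, Duminil-Copin–Smirnov 2012 §2,
`sum_fibre_event_le`) and transport the event to the middle arc (AB99 §3.a,
`PolylineShellTraversals.lean`). No new definitions.
-/

noncomputable section

open scoped Classical
open Literature.Probability.LatticeModels

namespace Literature.Probability.RandomPlanarGeometry.SAW

/-! ### The chordal reduction -/

section Chordal

variable {Ω : Set ℂ} {δ : ℝ} {a b : HexVertex}

/-- The lattice points of a rescaled list: `(l.map c).get` is `c` of `l.get`. [folklore] -/
theorem get_map_hexCenter (l : List HexVertex) (i : Fin (l.map hexCenter).length) :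
    (l.map hexCenter).get i = hexCenter (l.get (i.cast (List.length_map _))) := by
  simp [List.get_eq_getElem]

/-- **Virginization, chordal case.** Let `Ω_δ` be a discrete hexagonal domain with finitely many
SAWs from `a` to `b`, both at lattice distance `> N` from `z₀`, and let the vertex set `Λ₀` contain
the support of every such SAW and every cell of the open `N`-disc about `z₀`. Suppose that for every
vertex set `Λ'` containing the cells of the open `N`-disc and every two DOORS `m, m'` on the
`N`-circle (edges of `ℍ` from outside `Λ'` at distance `> N` to a vertex of `Ω_δ` in `Λ'` at distance
`≤ N`), the `x`-mass of the self-avoiding arcs `m → m'` of `Λ'` using edges of `Ω_δ` whose polyline has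
`k₀` separate traversals of `D(z₀; n, N/2)` is at most `C` times the `x`-mass of all of them. Then the `x^{#vertices}`-mass of the SAWs `a → b` whose vertex sequence has
`2(k₀+1)` weak vertex traversals of `D(z₀; r, R)` (`r + 1 < R`, `r ≤ n`, `N/2 ≤ R`, `R + 1 ≤ N`, edges
of `ℍ` have length `≤ 1`) is at most `C` times the total mass: cut each such SAW at its first and
last vertex in `B̄(z₀, N)` (two-sided domain Markov property) and transport the event to the arc.
[cite: DuminilCopinSmirnov2012, §2 (walks between mid-edges)] -/
theorem sum_vertexTraversals_le_chordal [Fintype (HexDomainSAW Ω δ a b)] {z₀ : ℂ}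
    {N n r R C x : ℝ} {k₀ : ℕ}
    (Λ₀ : Finset HexVertex) (hΛ₀ : ∀ (ω : HexDomainSAW Ω δ a b), ∀ v ∈ ω.walk.support, v ∈ Λ₀)
    (hdisc : ∀ v : HexVertex, dist (hexCenter v) z₀ < N → v ∈ Λ₀)
    (hsupp : ∀ (ω : HexDomainSAW Ω δ a b), ∀ v ∈ ω.walk.support,
      v ∈ embMeshDomain hexGraph hexCenter Ω δ)
    (hx : 0 ≤ x) (hC : 0 ≤ C)
    (hrR : r + 1 < R) (hrn : r ≤ n) (hNR : N / 2 ≤ R) (hRN : R + 1 ≤ N)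
    (hedge : ∀ u v : HexVertex, hexGraph.Adj u v → dist (hexCenter u) (hexCenter v) ≤ 1)
    (ha : N < dist (hexCenter a) z₀) (hb : N < dist (hexCenter b) z₀)
    (hArc : ∀ (Λ' : Finset HexVertex) (m m' : Sym2 HexVertex),
      (∀ v : HexVertex, dist (hexCenter v) z₀ < N → v ∈ Λ') →
      (∃ u c : HexVertex, m = s(u, c) ∧ hexGraph.Adj u c ∧ u ∉ Λ' ∧ c ∈ Λ' ∧
        c ∈ embMeshDomain hexGraph hexCenter Ω δ ∧ dist (hexCenter c) z₀ ≤ N ∧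
        N < dist (hexCenter u) z₀) →
      (∃ u c : HexVertex, m' = s(u, c) ∧ hexGraph.Adj u c ∧ u ∉ Λ' ∧ c ∈ Λ' ∧
        c ∈ embMeshDomain hexGraph hexCenter Ω δ ∧ dist (hexCenter c) z₀ ≤ N ∧
        N < dist (hexCenter u) z₀) →
      ∑ α : HexMidEdgeSAW Λ' m m', (if α.verts.IsChain (hexDomainGraph Ω δ).Adj ∧
          (⟨polyline α.points⟩ : Curve ℂ).HasTraversals k₀ z₀ n (N / 2) then x ^ α.length else 0) ≤
        C * ∑ α : HexMidEdgeSAW Λ' m m',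
          (if α.verts.IsChain (hexDomainGraph Ω δ).Adj then x ^ α.length else 0)) :
    ∑ ω ∈ (Finset.univ : Finset (HexDomainSAW Ω δ a b)).filter (fun ω =>
        ∃ ι κ : Fin (2 * (k₀ + 1)) → Fin (ω.walk.support.map hexCenter).length, (∀ m, ι m ≤ κ m) ∧
          (∀ m, (dist ((ω.walk.support.map hexCenter).get (ι m)) z₀ ≤ r ∧
              R ≤ dist ((ω.walk.support.map hexCenter).get (κ m)) z₀) ∨
            (R ≤ dist ((ω.walk.support.map hexCenter).get (ι m)) z₀ ∧
              dist ((ω.walk.support.map hexCenter).get (κ m)) z₀ ≤ r)) ∧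
          ∀ ⦃m m'⦄, m < m' → κ m ≤ ι m'),
      x ^ ω.vertexCount ≤ C * ∑ ω : HexDomainSAW Ω δ a b, x ^ ω.vertexCount := by
  -- far / near (an opaque Boolean predicate)
  obtain ⟨far, hfar⟩ : ∃ far : HexVertex → Bool, ∀ v, far v = decide (N < dist (hexCenter v) z₀) :=
    ⟨_, fun _ => rfl⟩
  have hfar_iff : ∀ v, far v = true ↔ N < dist (hexCenter v) z₀ := fun v => by simp [hfar]
  have hfar_ff : ∀ v, far v = false ↔ dist (hexCenter v) z₀ ≤ N := fun v => by simp [hfar]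
  have hrN : r ≤ N := by linarith
  -- the event, as an opaque predicate on vertex lists
  obtain ⟨EV, hEV⟩ : ∃ EV : List HexVertex → Prop, ∀ L, EV L ↔
      ∃ ι κ : Fin (2 * (k₀ + 1)) → Fin (L.map hexCenter).length, (∀ m, ι m ≤ κ m) ∧
        (∀ m, (dist ((L.map hexCenter).get (ι m)) z₀ ≤ r ∧ R ≤ dist ((L.map hexCenter).get (κ m)) z₀) ∨
          (R ≤ dist ((L.map hexCenter).get (ι m)) z₀ ∧ dist ((L.map hexCenter).get (κ m)) z₀ ≤ r)) ∧
        ∀ ⦃m m'⦄, m < m' → κ m ≤ ι m' := ⟨_, fun _ => Iff.rfl⟩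
  rw [Finset.filter_congr (fun ω _ => (hEV ω.walk.support).symm)]
  set S := (Finset.univ : Finset (HexDomainSAW Ω δ a b)).filter (fun ω => EV ω.walk.support)
    with hS
  -- the group map (opaque)
  obtain ⟨grp, hgrp⟩ : ∃ grp : HexDomainSAW Ω δ a b → List HexVertex × Option HexVertex ×
      Option HexVertex × Option HexVertex × Option HexVertex × List HexVertex, ∀ ω, grp ω =
    ((ω.walk.support.takeWhile far).dropLast, (ω.walk.support.takeWhile far).getLast?,
      (((ω.walk.support.dropWhile far).reverse.dropWhile far).reverse).head?,
      (((ω.walk.support.dropWhile far).reverse.dropWhile far).reverse).getLast?,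
      (((ω.walk.support.dropWhile far).reverse.takeWhile far).reverse).head?,
      (((ω.walk.support.dropWhile far).reverse.takeWhile far).reverse).tail) := ⟨_, fun _ => rfl⟩
  -- every SAW of the event is near somewhere
  have hnear : ∀ ω ∈ S, ∃ v ∈ ω.walk.support, far v = false := by
    intro ω hω
    obtain ⟨p, hp, hpr⟩ := exists_dist_le_of_vertexTraversals ((hEV _).1 (Finset.mem_filter.1 hω).2)
      (by omega)
    obtain ⟨v, hv, rfl⟩ := List.mem_map.1 hp
    exact ⟨v, hv, (hfar_ff v).2 (hpr.trans hrN)⟩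
  -- the structure of the cut of a SAW of the event
  have hcut : ∀ ω ∈ S, ∃ (β₀ c β₀' : List HexVertex) (p₀ p₀' : HexVertex) (hc : c ≠ []),
      ω.walk.support = β₀ ++ p₀ :: (c ++ p₀' :: β₀') ∧
      grp ω = (β₀, some p₀, some (c.head hc), some (c.getLast hc), some p₀', β₀') ∧
      (∀ v ∈ β₀ ++ [p₀], far v = true) ∧ (∀ v ∈ p₀' :: β₀', far v = true) ∧
      far (c.head hc) = false ∧ far (c.getLast hc) = false := by
    intro ω hω
    have hL : ω.walk.support ≠ [] := ω.walk.support_ne_nil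
    have hh : far (ω.walk.support.head hL) = true := by
      rw [SimpleGraph.Walk.head_support]; exact (hfar_iff a).2 ha
    have hl : far (ω.walk.support.getLast hL) = true := by
      rw [SimpleGraph.Walk.getLast_support]; exact (hfar_iff b).2 hb
    obtain ⟨hβne, -, hmidne, hsufne, hdec, hβfar, hsuffar, hmidhead, hmidlast⟩ :=
      decomp_far far hL hh hl (hnear ω hω)
    set β := ω.walk.support.takeWhile far with hβ
    set mid := ((ω.walk.support.dropWhile far).reverse.dropWhile far).reverse with hmid
    set suf := ((ω.walk.support.dropWhile far).reverse.takeWhile far).reverse with hsuf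
    refine ⟨β.dropLast, mid, suf.tail, β.getLast hβne, suf.head hsufne, hmidne, ?_, ?_, ?_, ?_,
      hmidhead hmidne, hmidlast hmidne⟩
    · calc ω.walk.support = β ++ (mid ++ suf) := hdec
        _ = (β.dropLast ++ [β.getLast hβne]) ++ (mid ++ (suf.head hsufne :: suf.tail)) := by
            rw [List.dropLast_append_getLast, List.cons_head_tail]
        _ = _ := by simp
    · rw [hgrp]
      simp only [← hβ, ← hmid, ← hsuf, List.getLast?_eq_some_getLast hβne,
        List.head?_eq_some_head hmidne, List.getLast?_eq_some_getLast hmidne,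
        List.head?_eq_some_head hsufne]
    · intro v hv; rw [List.dropLast_append_getLast] at hv; exact hβfar v hv
    · intro v hv; rw [List.cons_head_tail] at hv; exact hsuffar v hv
  -- fibrewise
  rw [← Finset.sum_fiberwise_of_maps_to (fun ω hω => Finset.mem_image_of_mem grp hω)
    (s := S) (t := S.image grp)]
  have hnn : ∀ ω : HexDomainSAW Ω δ a b, 0 ≤ x ^ ω.vertexCount := fun ω => pow_nonneg hx _
  -- the bound on each fibre
  have key : ∀ g ∈ S.image grp, ∑ ω ∈ S.filter (fun ω => grp ω = g), x ^ ω.vertexCount ≤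
      C * ∑ ω ∈ Finset.univ.filter (fun ω => grp ω = g), x ^ ω.vertexCount := by
    intro g hg
    obtain ⟨ω₀, hω₀, rfl⟩ := Finset.mem_image.1 hg
    obtain ⟨β₀, c₀, β₀', p₀, p₀', hc₀, h₀, hg₀, hβfar, hβ'far, hc₁n, hcLn⟩ := hcut ω₀ hω₀
    -- name the two near ends of the middle piece
    obtain ⟨c₁, hc₁⟩ : ∃ c₁, c₀.head hc₀ = c₁ := ⟨_, rfl⟩
    obtain ⟨c_L, hcL⟩ : ∃ c_L, c₀.getLast hc₀ = c_L := ⟨_, rfl⟩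
    rw [hc₁] at hg₀ hc₁n
    rw [hcL] at hg₀ hcLn
    have hc₁mem : c₁ ∈ c₀ := hc₁ ▸ List.head_mem hc₀
    have hcLmem : c_L ∈ c₀ := hcL ▸ List.getLast_mem hc₀
    -- facts about the witness
    have hnd : (β₀ ++ p₀ :: (c₀ ++ p₀' :: β₀')).Nodup := h₀ ▸ ω₀.isPath.support_nodup
    have hchain : (β₀ ++ p₀ :: (c₀ ++ p₀' :: β₀')).IsChain (hexDomainGraph Ω δ).Adj :=
      h₀ ▸ ω₀.walk.isChain_adj_support
    have e1 : ∀ c : List HexVertex,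
        β₀ ++ p₀ :: (c ++ p₀' :: β₀') = (β₀ ++ [p₀]) ++ (c ++ p₀' :: β₀') := fun c => by simp
    have e2 : ∀ c : List HexVertex,
        β₀ ++ p₀ :: (c ++ p₀' :: β₀') = (β₀ ++ p₀ :: c) ++ (p₀' :: β₀') := fun c => by simp
    have hadj₁ : hexGraph.Adj p₀ c₁ := by
      rw [e1] at hchain
      have := hchain.rel_getLast_head_of_append (by simp) (by simp [hc₀])
      simp only [List.getLast_append_of_ne_nil _ (List.cons_ne_nil p₀ []), List.getLast_singleton,
        List.head_append_of_ne_nil hc₀, hc₁] at this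
      exact embDomainGraph_le _ _ _ _ this
    have hadj₂ : hexGraph.Adj c_L p₀' := by
      rw [e2] at hchain
      have := hchain.rel_getLast_head_of_append (by simp) (by simp)
      simp only [List.getLast_append_of_ne_nil _ (List.cons_ne_nil p₀ c₀), List.getLast_cons hc₀,
        List.head_cons, hcL] at this
      exact embDomainGraph_le _ _ _ _ this
    have hc₁Λ : c₁ ∈ Λ₀ := hΛ₀ ω₀ _ (by rw [h₀]; simp [hc₁mem])
    have hcLΛ : c_L ∈ Λ₀ := hΛ₀ ω₀ _ (by rw [h₀]; simp [hcLmem])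
    have hc₁pre : c₁ ∉ β₀ ++ [p₀] := fun h => by
      rw [e1] at hnd
      exact List.disjoint_of_nodup_append hnd h (by simp [hc₁mem])
    have hc₁suf : c₁ ∉ p₀' :: β₀' := fun h => by
      rw [e1] at hnd
      exact List.disjoint_of_nodup_append hnd.of_append_right hc₁mem h
    have hcLpre : c_L ∉ β₀ ++ [p₀] := fun h => by
      rw [e1] at hnd
      exact List.disjoint_of_nodup_append hnd h (by simp [hcLmem])
    have hcLsuf : c_L ∉ p₀' :: β₀' := fun h => by
      rw [e1] at hnd
      exact List.disjoint_of_nodup_append hnd.of_append_right hcLmem h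
    have hp₀far : N < dist (hexCenter p₀) z₀ := (hfar_iff _).1 (hβfar p₀ (by simp))
    have hp₀'far : N < dist (hexCenter p₀') z₀ := (hfar_iff _).1 (hβ'far p₀' (by simp))
    have hc₁near : dist (hexCenter c₁) z₀ ≤ N := (hfar_ff _).1 hc₁n
    have hcLnear : dist (hexCenter c_L) z₀ ≤ N := (hfar_ff _).1 hcLn
    have hc₁far : R ≤ dist (hexCenter c₁) z₀ := by
      have := hedge _ _ hadj₁
      linarith [dist_triangle (hexCenter p₀) (hexCenter c₁) z₀]
    have hcLfar : R ≤ dist (hexCenter c_L) z₀ := by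
      have := hedge _ _ hadj₂
      linarith [dist_triangle (hexCenter p₀') (hexCenter c_L) z₀,
        dist_comm (hexCenter c_L) (hexCenter p₀')]
    -- the vertex set of the fibre
    have hmemΛ' : ∀ v, v ∈ (Λ₀ \ (β₀ ++ [p₀]).toFinset) \ (p₀' :: β₀').toFinset ↔
        v ∈ Λ₀ ∧ v ∉ β₀ ++ [p₀] ∧ v ∉ p₀' :: β₀' := fun v => by
      simp only [Finset.mem_sdiff, List.mem_toFinset, and_assoc]
    have hVP : ∀ v : HexVertex, dist (hexCenter v) z₀ < N →
        v ∈ (Λ₀ \ (β₀ ++ [p₀]).toFinset) \ (p₀' :: β₀').toFinset := fun v hvN =>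
      (hmemΛ' v).2 ⟨hdisc v hvN, fun h => by have := (hfar_iff v).1 (hβfar v h); linarith,
        fun h => by have := (hfar_iff v).1 (hβ'far v h); linarith⟩
    have hSU₁ : ∃ u c : HexVertex, s(p₀, c₁) = s(u, c) ∧ hexGraph.Adj u c ∧
        u ∉ (Λ₀ \ (β₀ ++ [p₀]).toFinset) \ (p₀' :: β₀').toFinset ∧
        c ∈ (Λ₀ \ (β₀ ++ [p₀]).toFinset) \ (p₀' :: β₀').toFinset ∧
        c ∈ embMeshDomain hexGraph hexCenter Ω δ ∧
        dist (hexCenter c) z₀ ≤ N ∧ N < dist (hexCenter u) z₀ :=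
      ⟨p₀, c₁, rfl, hadj₁, fun h => ((hmemΛ' _).1 h).2.1 (by simp),
        (hmemΛ' _).2 ⟨hc₁Λ, hc₁pre, hc₁suf⟩, hsupp ω₀ _ (by rw [h₀]; simp [hc₁mem]), hc₁near,
        hp₀far⟩
    have hSU₂ : ∃ u c : HexVertex, s(c_L, p₀') = s(u, c) ∧ hexGraph.Adj u c ∧
        u ∉ (Λ₀ \ (β₀ ++ [p₀]).toFinset) \ (p₀' :: β₀').toFinset ∧
        c ∈ (Λ₀ \ (β₀ ++ [p₀]).toFinset) \ (p₀' :: β₀').toFinset ∧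
        c ∈ embMeshDomain hexGraph hexCenter Ω δ ∧
        dist (hexCenter c) z₀ ≤ N ∧ N < dist (hexCenter u) z₀ :=
      ⟨p₀', c_L, Sym2.eq_swap, hadj₂.symm, fun h => ((hmemΛ' _).1 h).2.2 (by simp),
        (hmemΛ' _).2 ⟨hcLΛ, hcLpre, hcLsuf⟩, hsupp ω₀ _ (by rw [h₀]; simp [hcLmem]), hcLnear,
        hp₀'far⟩
    have hAC := hArc _ s(p₀, c₁) s(c_L, p₀') hVP hSU₁ hSU₂
    -- the transport of the event to the arc
    have hEA : ∀ α : HexMidEdgeSAW ((Λ₀ \ (β₀ ++ [p₀]).toFinset) \ (p₀' :: β₀').toFinset)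
        s(p₀, c₁) s(c_L, p₀'),
        α.verts.IsChain (hexDomainGraph Ω δ).Adj → EV (β₀ ++ p₀ :: (α.verts ++ p₀' :: β₀')) →
        (⟨polyline α.points⟩ : Curve ℂ).HasTraversals k₀ z₀ n (N / 2) := by
      intro α hαchain hE
      obtain ⟨-, hne, -, hhead, hlast⟩ :=
        exists_hexDomainSAW_of_hexMidEdgeSAW ω₀ hc₀ h₀ hc₁ hcL α hαchain
      have hmap : (β₀ ++ p₀ :: (α.verts ++ p₀' :: β₀')).map hexCenter =
          (β₀ ++ [p₀]).map hexCenter ++ α.verts.map hexCenter ++ (p₀' :: β₀').map hexCenter := by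
        simp
      rw [hEV, hmap] at hE
      have hcne : α.verts.map hexCenter ≠ [] := by simpa using hne
      have h := hasTraversals_polyline_middle hcne (by linarith : r < R) hE
        (fun p hp => by
          obtain ⟨v, hv, rfl⟩ := List.mem_map.1 hp
          have := (hfar_iff v).1 (hβfar v hv); linarith)
        (fun p hp => by
          obtain ⟨v, hv, rfl⟩ := List.mem_map.1 hp
          have := (hfar_iff v).1 (hβ'far v hv); linarith)
        (by rw [List.head_map, hhead]; exact hc₁far)
        (by rw [List.getLast_map, hlast]; exact hcLfar)
        (hexMidpoint s(p₀, c₁)) (hexMidpoint s(c_L, p₀'))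
      exact (h.of_le (Nat.le_succ _)).mono' hrn hNR
    -- the fibre described by supports (opaque predicate)
    obtain ⟨P, hP⟩ : ∃ P : HexDomainSAW Ω δ a b → Prop, ∀ ω, P ω ↔ ∃ c : List HexVertex,
        ∃ hc : c ≠ [], ω.walk.support = β₀ ++ p₀ :: (c ++ p₀' :: β₀') ∧ c.head hc = c₁ ∧
          c.getLast hc = c_L := ⟨_, fun _ => Iff.rfl⟩
    have hsub₁ : S.filter (fun ω => grp ω = grp ω₀) ⊆ (Finset.univ.filter P).filter
        (fun ω => EV ω.walk.support) := by
      intro ω hω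
      rw [Finset.mem_filter] at hω
      obtain ⟨hωS, hωg⟩ := hω
      obtain ⟨β₁, c, β₁', q₀, q₀', hc, h₁, hg₁, -, -, -, -⟩ := hcut ω hωS
      rw [hg₁, hg₀] at hωg
      simp only [Prod.mk.injEq, Option.some.injEq] at hωg
      obtain ⟨rfl, rfl, h3, h4, rfl, rfl⟩ := hωg
      refine Finset.mem_filter.2 ⟨Finset.mem_filter.2 ⟨Finset.mem_univ _, (hP ω).2 ⟨c, hc, h₁, h3, h4⟩⟩,
        ?_⟩
      exact (Finset.mem_filter.1 hωS).2
    have hsub₂ : Finset.univ.filter P ⊆ Finset.univ.filter (fun ω => grp ω = grp ω₀) := by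
      intro ω hω
      obtain ⟨c, hc, hsupp, hch, hcl⟩ := (hP ω).1 (Finset.mem_filter.1 hω).2
      refine Finset.mem_filter.2 ⟨Finset.mem_univ _, ?_⟩
      have hch' : far (c.head hc) = false := by rw [hch]; exact hc₁n
      have hcl' : far (c.getLast hc) = false := by rw [hcl]; exact hcLn
      rw [hg₀, hgrp, hsupp, takeWhile_eq_of_decomp far _ hc hβfar hch',
        dropWhile_eq_of_decomp far _ hc hβfar hch', reverse_takeWhile_reverse_eq_of_decomp far hc hβ'far hcl',
        reverse_dropWhile_reverse_eq_of_decomp far hc hβ'far hcl', List.dropLast_concat,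
        List.getLast?_concat, List.head?_eq_some_head hc, List.getLast?_eq_some_getLast hc, hch, hcl,
        List.head?_cons, List.tail_cons]
    -- assemble
    have hfib := sum_fibre_event_le ω₀ hc₀ h₀ hc₁ hcL Λ₀ hΛ₀ EV
      (fun α => (⟨polyline α.points⟩ : Curve ℂ).HasTraversals k₀ z₀ n (N / 2)) hEA hx hAC
    rw [Finset.filter_congr (fun ω _ => (hP ω).symm)] at hfib
    calc ∑ ω ∈ S.filter (fun ω => grp ω = grp ω₀), x ^ ω.vertexCount
        ≤ ∑ ω ∈ (Finset.univ.filter P).filter (fun ω => EV ω.walk.support), x ^ ω.vertexCount :=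
          Finset.sum_le_sum_of_subset_of_nonneg hsub₁ fun ω _ _ => hnn ω
      _ ≤ C * ∑ ω ∈ Finset.univ.filter P, x ^ ω.vertexCount := hfib
      _ ≤ C * ∑ ω ∈ Finset.univ.filter (fun ω => grp ω = grp ω₀), x ^ ω.vertexCount :=
          mul_le_mul_of_nonneg_left (Finset.sum_le_sum_of_subset_of_nonneg hsub₂ fun ω _ _ => hnn ω)
            hC
  calc ∑ g ∈ S.image grp, ∑ ω ∈ S.filter (fun ω => grp ω = g), x ^ ω.vertexCount
      ≤ ∑ g ∈ S.image grp, C * ∑ ω ∈ Finset.univ.filter (fun ω => grp ω = g), x ^ ω.vertexCount :=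
        Finset.sum_le_sum key
    _ = C * ∑ g ∈ S.image grp, ∑ ω ∈ Finset.univ.filter (fun ω => grp ω = g), x ^ ω.vertexCount := by
        rw [Finset.mul_sum]
    _ ≤ C * ∑ ω : HexDomainSAW Ω δ a b, x ^ ω.vertexCount :=
        mul_le_mul_of_nonneg_left (Finset.sum_fiberwise_le_sum_of_sum_fiber_nonneg
          fun g _ => Finset.sum_nonneg fun ω _ => hnn ω) hC

end Chordal

end Literature.Probability.RandomPlanarGeometry.SAW

end
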